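import Summits.QuantumFields.BalabanUV.T4Continuum.Spine.NE3.CovariantRoot
import Summits.QuantumFields.BalabanUV.T4Continuum.Support.AveragingDeficitTwoLevelPrep
import Literature.MathematicalPhysics.QuantumFieldTheory.Balaban1983to89.B7AvgGaugeCovariance
import Summits.QuantumFields.YangMills.Theorems.BalabanUVNodesN21ShellWeightKnit
import HarnessLib

/-!
# YM-DAG node N21 (= NE7c), THE IN-EDGE N16 ⊗ N21 JUNCTION — the two-run WIDTH (F∞) of the plaquette slot variables
# PRODUCED BY NAME from N16's statement of record `NE3EnergyWeightedCovShape.NE3EnergyRateWCov`, delivered in the three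
# currencies N21's roads consume: the pointwise closeness `|u^A − u^B| ≤ Δ_k` of `T4IndicatorShell` §3 (single-run
# shell domination of the mismatch pieces), the RELATIVE width in threshold units `≤ (C_Q∕ε)·θ^k` = the rate binder
# `hrate : ρ_j ≤ c₁ϑ^j` of road I (`n21_knit_levels` ∕ END-I `shellWeightBound_of_slotAC`) with `ϑ = θ = L^{−1∕6}`, and
# the offset-synchronised transfer «run B small ⇒ run A small up to a shell above its threshold» through
# [Balaban1985Averaging] Prop. 1 (11) (tree `B7Prop1Explicit.prop1_explicit`, PRINTED)

Track A of `YM-PLAN.md` (cell `pub-ymgap`, HUMAN RULING D-0062), node **N21** of 28 (cluster K5 «SpineMatching» of route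
`Summit.QuantumFields.YangMills.Theses.BalabanUVNodes`, item `SpineGivenEndpoint`).  Seat `pub-ymgap-dag-n21-a` (KNIT-BY-
NAME), file 3; files 1–2 are `BalabanUVNodesN21ShellWeightKnit` (p408928: the knit at explicit carriers, roads I∕II) and
`BalabanUVNodesN21ShellFactorJunction` (p409431: the N12 ⊗ N20 junction).  Filed `--supports stmt-QuantumFields-19182`.

HONEST FRAMING.  NE7c (`T4IndicatorShell.ShellWeightBound`) is NOT PRINTED in [Bałaban 1983–89] (one run is constructed
there; two-run threshold shells exist only in the cell's matching scheme, `T4IndicatorShell` design (i)) and is NOT PROVED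
here; N16 (= NE3, `NE3EnergyRateWCov … dom` for Bałaban's minimisers) is NOT PRINTED and NOT PROVED — it is THE HYPOTHESIS
`hcov` of every theorem of §3–§5 (exactly as in `BalabanUVNodesN16.closeness_of_n16` and `NE3.CovariantRoot`).  Kernel
bookkeeping over LANDED theorems BY NAME: 0 `def`, 0 `sorry`, standard axioms.  One finite four-torus at fixed `ε` — NOT
infinite volume, NOT ℝ⁴, NOT OS axioms, NOT a mass gap, NOT Clay.  COUNT-NEUTRAL (no world of record for the spine's
carriers: NODE 00 Stage 5 ∕ NODE O).

WHY THIS FILE (the in-edge census of files 1–2; dag-ref-B READ-8 «GAP-STATED»).  Road I's binders `hrateA ∕ hrateB :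
ρ_j ≤ c₁ϑ^j` (the (F∞)-rate «N16, NE3 species») and the closeness `|u^A − u^B| ≤ Δ` behind every ledger's `cover` field had NO
PRODUCER from N16's statement of record (every NE7c module takes the radii as free parameters: `LiveFactorJointLawModel`,
`T4LipschitzLedger.SupClose`).  The producer exists one node over: NE7 route #1's consumer END
`NE3.CovariantRoot.closeness_of_ne3EnergyRateWCov` (∘ `NE7EtaCurlFromCovGradient.closeness_of_covRoot₂`) turns `hcov` into, per
level `k ≥ 1` past the fit `γ(θ^k)² ≤ l₁N`, a unitary gauge `u` with (Q) `‖(u·U_A)(∂p) − W(∂p)‖ ≤ C_Q·θ^{13k}` at EVERY plaquette,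
`W := rescale L (bavg L U_B)` (run B's minimiser averaged once, read on run A's lattice), `θ⁶ = L⁻¹`,
`C_Q = 8l₁√(2γΛ₂′) + 1536l₁⁴γ²e^{8l₁²γ}`.  This file joins (Q) to N21.

WHAT IS PROVED ([folklore] arithmetic + applications BY NAME).
* §1 deviation calculus (any normed ring): `|‖a − 1‖ − ‖b − 1‖| ≤ ‖a − b‖` + GAUGE INVARIANCE of plaquette deviations
  ([Balaban1985Averaging] (45) p. 24, `B7AvgGaugeCovariance.norm_hol_gaugeAct_plaqWord`) ⇒ a closeness display in ANY unit-norm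
  gauge of run A bounds the difference of the slot variables `u^A(p) = ‖U_A(∂p) − 1‖`, `u^W(p) = ‖W(∂p) − 1‖`
  ([Balaban1988Convergent] (2.17) p. 257) — `dev_close_of_hol_close`.
* §2 `T4IndicatorShell` §3 BY NAME under such a display: the mismatch pieces of every plaquette slot at ANY common threshold
  lie in SINGLE-RUN shells of width `Δ` (`smallInd u^A t·(1 − smallInd u^W t) ≤ shellBelow u^A t Δ`, the large-field polarity; the W-side twins by `abs_sub_comm_le`)
  and X-15 V3's monotone device `χ_{t−Δ}(u^A) ≤ χ_t(u^W) ≤ χ_{t+Δ}(u^A)`.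
* §3 THE JUNCTION at `d = 4` (`dev_close_of_n16`): `hcov : NE3EnergyRateWCov 4 𝒞 L N b g C Λ₁ Λ₂′ dom` [N16 BY NAME] + the
  side letters of the consumer END ⇒ for every level `k ≥ 1` past the fit, datum `V ∈ dom`, minimiser pair `(U_A, U_B)`,
  `U_B` regular: `|u^A(p) − u^W(p)| ≤ C_Q·θ^{13k}` at every plaquette; `shell_domination_of_n16` = all four mismatch pieces.
* §4 THRESHOLD UNITS — the RATE binder: `θ < 1`; `θ^{13k} = θ^k·(L⁻¹)^{2k}` — the width is `θ^k`-small relative to the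
  squared spacing `(L^{−k})²` = the scale `η²` of the thresholds `ε_kη²` of (2.17); for any threshold `t ≥ ε·(L⁻¹)^{2k}`,
  `ε > 0`: `C_Qθ^{13k}∕t ≤ (C_Q∕ε)·θ^k` (`relWidth_le`, `relWidth_of_n16`) — LITERALLY `ρ_k ≤ c₁ϑ^k` with `c₁ = C_Q∕ε`,
  `ϑ = θ ∈ (0,1)`; summable (`summable_width`); eventually `≤ β′` (`eventually_width_le`, road (δ)'s `LiveFactorEventually` form).
* §5 INTO FILE 1 BY NAME (`n21_knit_levels_of_n16Width`): `n21_knit_levels` with both width families SET TO `j ↦ (C_Q∕ε)θ^j`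
  — the rate binders discharge by `le_rfl`; displayed remain [dict] + (M1) (the `LevelLedger`s AT THESE WIDTHS), N20's windows,
  `D ≤ D̄`.
* §6 THE ONE-SIDED TRANSFER (X-15 V3, B-small ⇒ A-small): `SmallField U_B a` (everywhere, `512·5·8·L²a ≤ 1`) ⇒ by
  [Balaban1985Averaging] Prop. 1 (11) BY NAME (`AveragingDeficitTwoLevelPrep.smallField_cavg`) `W` small at
  `prop1Radius 4 L a = L²a + 226(8·5·8·L²a)²` ⇒ every run-A slot variable `≤ prop1Radius 4 L a + C_Qθ^{13k}`
  (`devA_le_of_smallField_B`, `smallInd_A_eq_one_of_smallField_B`).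

WHAT THIS DOES NOT DO (named for dag-lead ∕ ref-B).  (a) `W` is run B READ ON THE COMMON LATTICE; run B's OWN test reads
`U_B`'s fine plaquettes at `ε_{k+1}(η∕L)²` — §6 gives the direction «B small ⇒ W small» (PRINTED, B7 Prop. 1); the converse
direction «a fine plaquette of `U_B` large ⇒ `W` not small at a lowered threshold» is the REGULARITY TRANSFER of [Balaban1989LargeFieldI]
p. 193 (binder `hreg` of `B15Chi175LargeFieldFactor`, in-edge N12's species) — not knit here.  (b) The tested variable of a
(2.17) slot is a `sup` over the plaquettes of a cube: §3 is per plaquette, uniform in the plaquette, so the `sup` inherits the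
same width (finite `sup` of a `Δ`-close family) — the cube bookkeeping is the term OBJECT's (NODE O).  (c) Nothing of (M1) ∕
road (δ) ∕ the term object is touched; NE7c NOT proved; N16 a HYPOTHESIS.
-/

set_option autoImplicit false

noncomputable section

open scoped BigOperators Matrix Matrix.Norms.L2Operator

namespace Summit.QuantumFields.YangMills.Theorems.N21ClosenessJunction

open Literature.MathematicalPhysics.QuantumFieldTheory.Balaban1983to89
open B7Prop1Explicit B7Prop2Explicit
open B7AvgGaugeCovariance (norm_hol_gaugeAct_plaqWord)
open T4IndicatorShell (smallInd largeInd shellBelow shellAbove smallInd_mul_one_sub_le largeInd_mul_one_sub_le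
  abs_sub_comm_le smallInd_offset_mono_left smallInd_offset_mono_right ShellWeightBound)
open T4AveragingDeficitWall (IsUnitaryCfg SmallField)
open T4ShellMeasureLevels (LevelLedger LiveWindow)
open Summit.QuantumFields.BalabanUV.T4Continuum
open MinimalActionSandwich (IsMinimiser)
open MinimalActionRate (Regular)
open NE3EnergyShapes (IsUnitarySite)
open NE3EnergyWeightedCovShape (NE3EnergyRateWCov)
open NE3.CovariantRoot (closeness_of_ne3EnergyRateWCov)
open AveragingDeficitTransport (mem_U1_of_unitary)
open AveragingDeficitTwoLevelPrep (prop1Radius smallField_cavg)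
open AveragingDeficitDualResidual (dualC1 dualC2)
open AveragingDeficitDerivWallProof (wallConst)

/-! ## §1 Deviation calculus: reverse triangle and gauge invariance of plaquette deviations -/

section Dev

variable {𝔸 : Type*} [NormedRing 𝔸] [NormOneClass 𝔸] {d : ℕ}

omit [NormOneClass 𝔸] in
/-- Reverse triangle inequality for deviations from `1`: `|‖a − 1‖ − ‖b − 1‖| ≤ ‖a − b‖`. [folklore] -/
theorem abs_dev_sub_dev_le (a b : 𝔸) : |‖a - 1‖ - ‖b - 1‖| ≤ ‖a - b‖ := by
  have h := abs_norm_sub_norm_le (a - 1) (b - 1)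
  rwa [sub_sub_sub_cancel_right] at h

/-- The plaquette deviations `‖V(∂p) − 1‖`, `‖W(∂p) − 1‖` differ by at most the distance of the plaquette variables of `u·V` and
`W` for ANY gauge `u` valued in `{|u| ≤ 1, |u⁻¹| ≤ 1}` — deviations are gauge invariant ([Balaban1985Averaging] (45) p. 24). [folklore] -/
theorem abs_dev_sub_dev_le_of_gauge {u : Site d → 𝔸ˣ} (hu : ∀ x, u x ∈ U1 𝔸) (V W : Site d → Fin d → 𝔸ˣ)
    (x : Site d) (κ ν : Fin d) :
    |‖((hol V x (plaqWord κ ν) : 𝔸ˣ) : 𝔸) - 1‖ - ‖((hol W x (plaqWord κ ν) : 𝔸ˣ) : 𝔸) - 1‖|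
      ≤ ‖((hol (gaugeAct u V) x (plaqWord κ ν) : 𝔸ˣ) : 𝔸) - ((hol W x (plaqWord κ ν) : 𝔸ˣ) : 𝔸)‖ := by
  rw [← norm_hol_gaugeAct_plaqWord hu V x κ ν]
  exact abs_dev_sub_dev_le _ _

/-- **FROM A CLOSENESS DISPLAY TO THE SLOT VARIABLES.**  If in some unit-norm gauge `u` every plaquette variable of `u·V` is
within `Δ` of that of `W`, the SLOT VARIABLES `u^V(p) = ‖V(∂p) − 1‖`, `u^W(p) = ‖W(∂p) − 1‖` ([Balaban1988Convergent] (2.17)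
p. 257) differ by at most `Δ` at every plaquette — the pointwise (F∞) currency of `T4IndicatorShell` §3. [folklore] -/
theorem dev_close_of_hol_close {u : Site d → 𝔸ˣ} (hu : ∀ x, u x ∈ U1 𝔸) {V W : Site d → Fin d → 𝔸ˣ} {Δ : ℝ}
    (hQ : ∀ (x : Site d) (κ ν : Fin d),
      ‖((hol (gaugeAct u V) x (plaqWord κ ν) : 𝔸ˣ) : 𝔸) - ((hol W x (plaqWord κ ν) : 𝔸ˣ) : 𝔸)‖ ≤ Δ)
    (x : Site d) (κ ν : Fin d) :
    |‖((hol V x (plaqWord κ ν) : 𝔸ˣ) : 𝔸) - 1‖ - ‖((hol W x (plaqWord κ ν) : 𝔸ˣ) : 𝔸) - 1‖| ≤ Δ :=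
  (abs_dev_sub_dev_le_of_gauge hu V W x κ ν).trans (hQ x κ ν)

/-! ## §2 The pointwise currency of `T4IndicatorShell` §3 BY NAME: single-run shell domination of the mismatch pieces -/

variable {u : Site d → 𝔸ˣ} {V W : Site d → Fin d → 𝔸ˣ} {Δ : ℝ}

/-- **SMALL-FIELD SLOTS.**  Under the closeness display the mismatch «`V` small at `t`, `W` not small at `t`» of the slot
`(x; κν)` lies in `V`'s OWN shell below `t` of width `Δ` (`T4IndicatorShell.smallInd_mul_one_sub_le`). [folklore] -/
theorem smallInd_mismatch_le_shellBelow (hu : ∀ x, u x ∈ U1 𝔸)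
    (hQ : ∀ (x : Site d) (κ ν : Fin d),
      ‖((hol (gaugeAct u V) x (plaqWord κ ν) : 𝔸ˣ) : 𝔸) - ((hol W x (plaqWord κ ν) : 𝔸ˣ) : 𝔸)‖ ≤ Δ)
    (x : Site d) (κ ν : Fin d) (t : ℝ) :
    smallInd ‖((hol V x (plaqWord κ ν) : 𝔸ˣ) : 𝔸) - 1‖ t * (1 - smallInd ‖((hol W x (plaqWord κ ν) : 𝔸ˣ) : 𝔸) - 1‖ t)
      ≤ shellBelow ‖((hol V x (plaqWord κ ν) : 𝔸ˣ) : 𝔸) - 1‖ t Δ :=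
  smallInd_mul_one_sub_le (dev_close_of_hol_close hu hQ x κ ν)

/-- **LARGE-FIELD SLOTS**: the mismatch «`V` large at `t`, `W` not large» lies in `V`'s own shell ABOVE `t` of width `Δ`. [folklore] -/
theorem largeInd_mismatch_le_shellAbove (hu : ∀ x, u x ∈ U1 𝔸)
    (hQ : ∀ (x : Site d) (κ ν : Fin d),
      ‖((hol (gaugeAct u V) x (plaqWord κ ν) : 𝔸ˣ) : 𝔸) - ((hol W x (plaqWord κ ν) : 𝔸ˣ) : 𝔸)‖ ≤ Δ)
    (x : Site d) (κ ν : Fin d) (t : ℝ) :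
    largeInd ‖((hol V x (plaqWord κ ν) : 𝔸ˣ) : 𝔸) - 1‖ t * (1 - largeInd ‖((hol W x (plaqWord κ ν) : 𝔸ˣ) : 𝔸) - 1‖ t)
      ≤ shellAbove ‖((hol V x (plaqWord κ ν) : 𝔸ˣ) : 𝔸) - 1‖ t Δ :=
  largeInd_mul_one_sub_le (dev_close_of_hol_close hu hQ x κ ν)

/-- **THE MONOTONE DEVICE of X-15 V3** under the closeness display: `χ_{t−Δ}(u^V) ≤ χ_t(u^W) ≤ χ_{t+Δ}(u^V)` at every plaquette
slot (`T4IndicatorShell.smallInd_offset_mono_left ∕ _right`). [folklore] -/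
theorem smallInd_offset_sandwich (hu : ∀ x, u x ∈ U1 𝔸)
    (hQ : ∀ (x : Site d) (κ ν : Fin d),
      ‖((hol (gaugeAct u V) x (plaqWord κ ν) : 𝔸ˣ) : 𝔸) - ((hol W x (plaqWord κ ν) : 𝔸ˣ) : 𝔸)‖ ≤ Δ)
    (x : Site d) (κ ν : Fin d) (t : ℝ) :
    smallInd ‖((hol V x (plaqWord κ ν) : 𝔸ˣ) : 𝔸) - 1‖ (t - Δ) ≤ smallInd ‖((hol W x (plaqWord κ ν) : 𝔸ˣ) : 𝔸) - 1‖ t ∧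
      smallInd ‖((hol W x (plaqWord κ ν) : 𝔸ˣ) : 𝔸) - 1‖ t ≤ smallInd ‖((hol V x (plaqWord κ ν) : 𝔸ˣ) : 𝔸) - 1‖ (t + Δ) :=
  ⟨smallInd_offset_mono_left (dev_close_of_hol_close hu hQ x κ ν),
    smallInd_offset_mono_right (dev_close_of_hol_close hu hQ x κ ν)⟩

end Dev

/-! ## §3 THE JUNCTION at `d = 4`: N16's statement of record ⇒ the two-run width of the plaquette slot variables -/

section Junction

variable {n : Type*} [Fintype n] [DecidableEq n] [Nonempty n]
  {𝒞 : ℕ → Set (Site 4 → Fin 4 → (Matrix n n ℂ)ˣ)} {L N : ℕ} {θ b g C Λ₁ Λ₂' γ l₁ : ℝ}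
  {dom : Set (Site 4 → Fin 4 → (Matrix n n ℂ)ˣ)} {k : ℕ} {V UA UB : Site 4 → Fin 4 → (Matrix n n ℂ)ˣ}

/-- **THE N16 ⊗ N21 JUNCTION.**  HYPOTHESES: N16's statement of record `hcov : NE3EnergyRateWCov 4 𝒞 L N b g C Λ₁ Λ₂′ dom`
(NOT PRINTED, NOT PROVED — the in-edge BY NAME) and the side letters of its consumer END `NE3.CovariantRoot.
closeness_of_ne3EnergyRateWCov` (`L ≥ 2`, `N ≥ 1`, `θ⁶ = L⁻¹`, class data `b, g`, budget `γ` with `C·ρ₄ ≤ γ³`, cube root `l₁` of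
`Λ₁`, a level `k ≥ 1` past the fit `γ(θ^k)² ≤ l₁N`, a datum `V ∈ dom`, run A's minimiser `U_A` at level `k`, run B's `U_B` at
level `k+1`, regular).  CONCLUSION: at EVERY plaquette of run A's lattice the slot variables `u^A = ‖U_A(∂p) − 1‖` and
`u^W = ‖W(∂p) − 1‖`, `W = rescale L (bavg L U_B)`, differ by at most `C_Q·θ^{13k}`,
`C_Q = 8l₁√(2γΛ₂′) + 1536l₁⁴γ²e^{8l₁²γ}` — (Q) of the consumer END made gauge-free by §1. [folklore] -/
theorem dev_close_of_n16 (hL : 2 ≤ L) (hN : 1 ≤ N) (hθ : 0 < θ) (hθ6 : θ ^ 6 = ((L : ℝ))⁻¹) (hb : 0 ≤ b)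
    (hbs : 512 * (4 + 1) * (4 + 4) * (L : ℝ) ^ 2 * b ≤ 1) (hg : 0 ≤ g) (hC : 0 ≤ C) (hΛ₂' : 0 < Λ₂')
    (hcov : NE3EnergyRateWCov 4 𝒞 L N b g C Λ₁ Λ₂' dom)
    (hγ : 0 < γ) (hγ3 : C * (wallConst 4 L * (N : ℝ) ^ 2 * (Real.sqrt g * dualC2 4 L + 2 * b ^ 2 * dualC1 4 L)) ≤ γ ^ 3)
    (hl₁ : 0 < l₁) (hΛl₁ : Λ₁ ≤ l₁ ^ 3) (hk : 1 ≤ k) (hfit : γ * (θ ^ k) ^ 2 ≤ l₁ * N) (hV : V ∈ dom)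
    (hA : IsMinimiser 4 𝒞 L N k V UA) (hB : IsMinimiser 4 𝒞 L N (k + 1) V UB) (hreg : Regular 4 L N b g (k + 1) UB)
    (z : Site 4) (μ ν : Fin 4) :
    |‖((hol UA z (plaqWord μ ν) : (Matrix n n ℂ)ˣ) : Matrix n n ℂ) - 1‖
        - ‖((hol (rescale L (bavg L UB)) z (plaqWord μ ν) : (Matrix n n ℂ)ˣ) : Matrix n n ℂ) - 1‖|
      ≤ (8 * l₁ * Real.sqrt (2 * γ * Λ₂') + 1536 * l₁ ^ 4 * γ ^ 2 * Real.exp (8 * l₁ ^ 2 * γ)) * θ ^ (13 * k) := by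
  obtain ⟨u, Z, hu, -, -, -, -, -, -, -, hQ⟩ :=
    closeness_of_ne3EnergyRateWCov hL hN hθ hθ6 hb hbs hg hC hΛ₂' hcov hγ hγ3 hl₁ hΛl₁ hk hfit hV hA hB hreg
  exact dev_close_of_hol_close (fun x => mem_U1_of_unitary (hu x)) hQ z μ ν

/-- **SHELL DOMINATION FROM N16.**  Under the hypotheses of `dev_close_of_n16`, at every plaquette slot and EVERY common
threshold `t` the four mismatch pieces of the two runs' sharp indicators lie in single-run shells of width `C_Q·θ^{13k}`
(§2 at the N16 width) — the `cover` step of every N21 ledger (`T4ShellMeasure.SlotLedger.cover`) per plaquette. [folklore] -/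
theorem shell_domination_of_n16 (hL : 2 ≤ L) (hN : 1 ≤ N) (hθ : 0 < θ) (hθ6 : θ ^ 6 = ((L : ℝ))⁻¹) (hb : 0 ≤ b)
    (hbs : 512 * (4 + 1) * (4 + 4) * (L : ℝ) ^ 2 * b ≤ 1) (hg : 0 ≤ g) (hC : 0 ≤ C) (hΛ₂' : 0 < Λ₂')
    (hcov : NE3EnergyRateWCov 4 𝒞 L N b g C Λ₁ Λ₂' dom)
    (hγ : 0 < γ) (hγ3 : C * (wallConst 4 L * (N : ℝ) ^ 2 * (Real.sqrt g * dualC2 4 L + 2 * b ^ 2 * dualC1 4 L)) ≤ γ ^ 3)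
    (hl₁ : 0 < l₁) (hΛl₁ : Λ₁ ≤ l₁ ^ 3) (hk : 1 ≤ k) (hfit : γ * (θ ^ k) ^ 2 ≤ l₁ * N) (hV : V ∈ dom)
    (hA : IsMinimiser 4 𝒞 L N k V UA) (hB : IsMinimiser 4 𝒞 L N (k + 1) V UB) (hreg : Regular 4 L N b g (k + 1) UB)
    (z : Site 4) (μ ν : Fin 4) (t : ℝ) :
    let uA : ℝ := ‖((hol UA z (plaqWord μ ν) : (Matrix n n ℂ)ˣ) : Matrix n n ℂ) - 1‖
    let uW : ℝ := ‖((hol (rescale L (bavg L UB)) z (plaqWord μ ν) : (Matrix n n ℂ)ˣ) : Matrix n n ℂ) - 1‖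
    let Δ : ℝ := (8 * l₁ * Real.sqrt (2 * γ * Λ₂') + 1536 * l₁ ^ 4 * γ ^ 2 * Real.exp (8 * l₁ ^ 2 * γ)) * θ ^ (13 * k)
    smallInd uA t * (1 - smallInd uW t) ≤ shellBelow uA t Δ ∧
      smallInd uW t * (1 - smallInd uA t) ≤ shellBelow uW t Δ ∧
      largeInd uA t * (1 - largeInd uW t) ≤ shellAbove uA t Δ ∧
      largeInd uW t * (1 - largeInd uA t) ≤ shellAbove uW t Δ := by
  have h := dev_close_of_n16 hL hN hθ hθ6 hb hbs hg hC hΛ₂' hcov hγ hγ3 hl₁ hΛl₁ hk hfit hV hA hB hreg z μ ν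
  exact ⟨smallInd_mul_one_sub_le h, smallInd_mul_one_sub_le (abs_sub_comm_le h),
    largeInd_mul_one_sub_le h, largeInd_mul_one_sub_le (abs_sub_comm_le h)⟩

end Junction

/-! ## §4 Threshold units: the width is `θ^k`-small relative to `(L^{−k})²` — the RATE binder `ρ_k ≤ c₁ϑ^k`, `ϑ = θ` -/

section Units

/-- `θ⁶ = L⁻¹` with `L ≥ 2` forces `θ < 1` (the sixth root `θ = L^{−1∕6}` of `NE7EtaRatesD4.exists_sixth_root`).
[folklore] -/
theorem theta_lt_one {L : ℕ} (hL : 2 ≤ L) {θ : ℝ} (hθ6 : θ ^ 6 = ((L : ℝ))⁻¹) : θ < 1 := by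
  by_contra h
  have h1 : (1 : ℝ) ≤ θ := not_lt.mp h
  have h2 : (1 : ℝ) ≤ θ ^ 6 := one_le_pow₀ h1
  have hL2 : (2 : ℝ) ≤ (L : ℝ) := by exact_mod_cast hL
  have h3 : ((L : ℝ))⁻¹ ≤ 2⁻¹ := inv_anti₀ (by norm_num) hL2
  rw [hθ6] at h2
  linarith

/-- `θ^{13k} = θ^k · (L⁻¹)^{2k}` (`θ⁶ = L⁻¹`): the width of §3 is `θ^k` times the SQUARED SPACING `(L^{−k})²` of level `k` — the
scale `η²` of the small-field thresholds `ε_kη²` of [Balaban1988Convergent] (2.17). [folklore] -/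
theorem pow_thirteen_mul_eq {L : ℕ} {θ : ℝ} (hθ6 : θ ^ 6 = ((L : ℝ))⁻¹) (k : ℕ) :
    θ ^ (13 * k) = θ ^ k * ((L : ℝ)⁻¹) ^ (2 * k) := by
  have e : 13 * k = k + 6 * (2 * k) := by ring
  rw [e, pow_add, pow_mul, hθ6]

/-- **RELATIVE WIDTH IN THRESHOLD UNITS (generic constant).**  A width `C_Q·θ^{13k}` measured against ANY threshold
`t ≥ ε·(L⁻¹)^{2k}` (a small-field threshold at least `ε > 0` in units of the squared spacing) is at most `(C_Q∕ε)·θ^k` —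
LITERALLY the rate shape `ρ_k ≤ c₁ϑ^k` of road I (`hrateA ∕ hrateB` of `n21_knit_levels`, `shellWeightBound_of_slotAC`) with
`c₁ = C_Q∕ε`, `ϑ = θ`. [folklore] -/
theorem relWidth_le {L : ℕ} (hL : 1 ≤ L) {θ CQ ε t : ℝ} (hθ6 : θ ^ 6 = ((L : ℝ))⁻¹) (hCQ : 0 ≤ CQ) (hε : 0 < ε)
    (hθ : 0 ≤ θ) (k : ℕ) (ht : ε * ((L : ℝ)⁻¹) ^ (2 * k) ≤ t) :
    CQ * θ ^ (13 * k) / t ≤ CQ / ε * θ ^ k := by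
  have hL0 : (0 : ℝ) < (L : ℝ) := by exact_mod_cast (by omega : 0 < L)
  have hs : 0 < ((L : ℝ)⁻¹) ^ (2 * k) := pow_pos (inv_pos.mpr hL0) _
  have ht0 : 0 < t := lt_of_lt_of_le (mul_pos hε hs) ht
  rw [pow_thirteen_mul_eq hθ6, div_le_iff₀ ht0]
  calc CQ * (θ ^ k * ((L : ℝ)⁻¹) ^ (2 * k)) = CQ / ε * θ ^ k * (ε * ((L : ℝ)⁻¹) ^ (2 * k)) := by
        field_simp
    _ ≤ CQ / ε * θ ^ k * t :=
        mul_le_mul_of_nonneg_left ht (mul_nonneg (div_nonneg hCQ hε.le) (pow_nonneg hθ k))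

/-- The N16 width family `k ↦ c₁·θ^k` is SUMMABLE (`0 ≤ θ < 1`) — the currency `Summable ρ` of the band twins
(`ShellMeasureRootComposition.shellWeightBound_of_slotAC_band`, `T4LipschitzCutoff`). [folklore] -/
theorem summable_width {L : ℕ} (hL : 2 ≤ L) {θ : ℝ} (hθ : 0 < θ) (hθ6 : θ ^ 6 = ((L : ℝ))⁻¹) (c₁ : ℝ) :
    Summable fun k : ℕ => c₁ * θ ^ k :=
  (summable_geometric_of_lt_one hθ.le (theta_lt_one hL hθ6)).mul_left c₁

/-- **EVENTUAL SMALLNESS** (the form road (δ) asks, `LiveFactorEventually`: closeness only for `K ≥ K₀`): for every `β′ > 0` the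
width `c₁·θ^k` is `≤ β′` from some level on. [folklore] -/
theorem eventually_width_le {L : ℕ} (hL : 2 ≤ L) {θ : ℝ} (hθ : 0 < θ) (hθ6 : θ ^ 6 = ((L : ℝ))⁻¹) (c₁ : ℝ) {β' : ℝ}
    (hβ' : 0 < β') : ∃ k₀ : ℕ, ∀ k, k₀ ≤ k → c₁ * θ ^ k ≤ β' := by
  have hlim : Filter.Tendsto (fun k : ℕ => c₁ * θ ^ k) Filter.atTop (nhds 0) := by
    simpa using (tendsto_pow_atTop_nhds_zero_of_lt_one hθ.le (theta_lt_one hL hθ6)).const_mul c₁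
  obtain ⟨k₀, hk₀⟩ := Filter.eventually_atTop.mp ((tendsto_order.mp hlim).2 β' hβ')
  exact ⟨k₀, fun k hk => (hk₀ k hk).le⟩

variable {n : Type*} [Fintype n] [DecidableEq n] [Nonempty n]
  {𝒞 : ℕ → Set (Site 4 → Fin 4 → (Matrix n n ℂ)ˣ)} {L N : ℕ} {θ b g C Λ₁ Λ₂' γ l₁ : ℝ}
  {dom : Set (Site 4 → Fin 4 → (Matrix n n ℂ)ˣ)} {k : ℕ} {V UA UB : Site 4 → Fin 4 → (Matrix n n ℂ)ˣ}

/-- **THE (F∞) RATE BINDER PRODUCED FROM N16.**  Under the hypotheses of `dev_close_of_n16` and for any threshold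
`t ≥ ε·(L⁻¹)^{2k}` (`ε > 0`), the RELATIVE two-run width of every plaquette slot variable at level `k` is at most
`(C_Q∕ε)·θ^k`: `|u^A − u^W|∕t ≤ (C_Q∕ε)·θ^k` — the in-edge «N16, NE3 species (F∞): ρ_j ≤ c₁ϑ^j» of files 1–2 with the EXPLICIT
letters `c₁ = C_Q∕ε`, `ϑ = θ = L^{−1∕6}`.  CONDITIONAL on `hcov` (N16). [folklore] -/
theorem relWidth_of_n16 (hL : 2 ≤ L) (hN : 1 ≤ N) (hθ : 0 < θ) (hθ6 : θ ^ 6 = ((L : ℝ))⁻¹) (hb : 0 ≤ b)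
    (hbs : 512 * (4 + 1) * (4 + 4) * (L : ℝ) ^ 2 * b ≤ 1) (hg : 0 ≤ g) (hC : 0 ≤ C) (hΛ₂' : 0 < Λ₂')
    (hcov : NE3EnergyRateWCov 4 𝒞 L N b g C Λ₁ Λ₂' dom)
    (hγ : 0 < γ) (hγ3 : C * (wallConst 4 L * (N : ℝ) ^ 2 * (Real.sqrt g * dualC2 4 L + 2 * b ^ 2 * dualC1 4 L)) ≤ γ ^ 3)
    (hl₁ : 0 < l₁) (hΛl₁ : Λ₁ ≤ l₁ ^ 3) (hk : 1 ≤ k) (hfit : γ * (θ ^ k) ^ 2 ≤ l₁ * N) (hV : V ∈ dom)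
    (hA : IsMinimiser 4 𝒞 L N k V UA) (hB : IsMinimiser 4 𝒞 L N (k + 1) V UB) (hreg : Regular 4 L N b g (k + 1) UB)
    {ε t : ℝ} (hε : 0 < ε) (ht : ε * ((L : ℝ)⁻¹) ^ (2 * k) ≤ t) (z : Site 4) (μ ν : Fin 4) :
    |‖((hol UA z (plaqWord μ ν) : (Matrix n n ℂ)ˣ) : Matrix n n ℂ) - 1‖
        - ‖((hol (rescale L (bavg L UB)) z (plaqWord μ ν) : (Matrix n n ℂ)ˣ) : Matrix n n ℂ) - 1‖| / t
      ≤ (8 * l₁ * Real.sqrt (2 * γ * Λ₂') + 1536 * l₁ ^ 4 * γ ^ 2 * Real.exp (8 * l₁ ^ 2 * γ)) / ε * θ ^ k := by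
  have hL0 : (0 : ℝ) < (L : ℝ) := by exact_mod_cast (by omega : 0 < L)
  have ht0 : 0 < t := lt_of_lt_of_le (mul_pos hε (pow_pos (inv_pos.mpr hL0) _)) ht
  have hCQ : 0 ≤ 8 * l₁ * Real.sqrt (2 * γ * Λ₂') + 1536 * l₁ ^ 4 * γ ^ 2 * Real.exp (8 * l₁ ^ 2 * γ) := by positivity
  have h := dev_close_of_n16 hL hN hθ hθ6 hb hbs hg hC hΛ₂' hcov hγ hγ3 hl₁ hΛl₁ hk hfit hV hA hB hreg z μ ν
  calc _ ≤ (8 * l₁ * Real.sqrt (2 * γ * Λ₂') + 1536 * l₁ ^ 4 * γ ^ 2 * Real.exp (8 * l₁ ^ 2 * γ)) * θ ^ (13 * k) / t :=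
        div_le_div_of_nonneg_right h ht0.le
    _ ≤ _ := relWidth_le (by omega : 1 ≤ L) hθ6 hCQ hε hθ.le k ht

end Units

/-! ## §5 Into file 1 BY NAME: road I's knit with both width families set to the N16 width -/

section IntoKnit

variable {ι σA σB : Type*} {l₀ : ℝ} {T : ℕ → Finset ι} {A B shA shB : ℕ → ℝ → ι → ℝ}
  {SA : ℕ → Finset σA} {SB : ℕ → Finset σB} {pieceA : ℕ → ℝ → σA → ι → ℝ} {pieceB : ℕ → ℝ → σB → ι → ℝ}
  {lvlA : ℕ → σA → ℕ} {lvlB : ℕ → σB → ℕ} {DA DB : ℕ → ℝ} {N₁ : ℕ} {νbar Dbar : ℝ}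

/-- **ROAD I AT THE N16 WIDTH.**  File 1's knit `n21_knit_levels` with BOTH runs' level-width families SET TO the N16 width in
threshold units `j ↦ (C_Q∕ε)·θ^j` (§4; `C_Q` any real here) and `θ⁶ = L⁻¹`, `L ≥ 2`: its rate binders `hrateA`, `hrateB`
DISCHARGE by `le_rfl` and `0 < ϑ = θ < 1` by `theta_lt_one`; the remaining displayed binders are exactly [dict] + (M1) — the
two `LevelLedger`s AT THESE WIDTHS (`cover` supplied per plaquette by §3; `slot` = THE WALL (M1) by level) — N20's live
windows, and `D ≤ D̄`.  CONCLUSION: `ShellWeightBound l₀ T A B shA shB Wsh` for every summable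
`Wsh ≥ 2((N₁+1)ν̄D̄(C_Q∕ε)θ^{−N₁})·θ^K`.  NE7c NOT proved. [folklore] -/
theorem n21_knit_levels_of_n16Width {L : ℕ} (hL : 2 ≤ L) {θ : ℝ} (hθ : 0 < θ) (hθ6 : θ ^ 6 = ((L : ℝ))⁻¹) (CQ ε : ℝ)
    (hA : LevelLedger l₀ T A shA SA pieceA lvlA DA (fun j => CQ / ε * θ ^ j))
    (hB : LevelLedger l₀ T B shB SB pieceB lvlB DB (fun j => CQ / ε * θ ^ j))
    (hwA : LiveWindow SA lvlA N₁ νbar) (hwB : LiveWindow SB lvlB N₁ νbar)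
    (hDA : ∀ j, DA j ≤ Dbar) (hDB : ∀ j, DB j ≤ Dbar)
    {Wsh : ℕ → ℝ} (hWsh : ∀ K, (2 * ((N₁ + 1) * νbar * Dbar * (CQ / ε) * θ⁻¹ ^ N₁)) * θ ^ K ≤ Wsh K)
    (hsum : Summable Wsh) : ShellWeightBound l₀ T A B shA shB Wsh :=
  n21_knit_levels hA hB hwA hwB hDA hDB hθ (theta_lt_one hL hθ6) (fun _ => le_rfl) (fun _ => le_rfl) hWsh hsum

/-- … and the closed form: the geometric weight `2((N₁+1)ν̄D̄(C_Q∕ε)θ^{−N₁})·θ^K` ITSELF is a shell-weight bound at the N16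
width (`n21_knit_levels_geometric`). [folklore] -/
theorem n21_knit_levels_of_n16Width_geometric {L : ℕ} (hL : 2 ≤ L) {θ : ℝ} (hθ : 0 < θ) (hθ6 : θ ^ 6 = ((L : ℝ))⁻¹)
    (CQ ε : ℝ)
    (hA : LevelLedger l₀ T A shA SA pieceA lvlA DA (fun j => CQ / ε * θ ^ j))
    (hB : LevelLedger l₀ T B shB SB pieceB lvlB DB (fun j => CQ / ε * θ ^ j))
    (hwA : LiveWindow SA lvlA N₁ νbar) (hwB : LiveWindow SB lvlB N₁ νbar)
    (hDA : ∀ j, DA j ≤ Dbar) (hDB : ∀ j, DB j ≤ Dbar) :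
    ShellWeightBound l₀ T A B shA shB fun K => (2 * ((N₁ + 1) * νbar * Dbar * (CQ / ε) * θ⁻¹ ^ N₁)) * θ ^ K :=
  n21_knit_levels_geometric hA hB hwA hwB hDA hDB hθ (theta_lt_one hL hθ6) (fun _ => le_rfl) (fun _ => le_rfl)

end IntoKnit

/-! ## §6 The one-sided transfer «run B small ⇒ run A small up to a shell above its threshold» (B7 Prop. 1 BY NAME) -/

section Transfer

variable {n : Type*} [Fintype n] [DecidableEq n] [Nonempty n]
  {𝒞 : ℕ → Set (Site 4 → Fin 4 → (Matrix n n ℂ)ˣ)} {L N : ℕ} {θ b g C Λ₁ Λ₂' γ l₁ : ℝ}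
  {dom : Set (Site 4 → Fin 4 → (Matrix n n ℂ)ˣ)} {k : ℕ} {V UA UB : Site 4 → Fin 4 → (Matrix n n ℂ)ˣ}

omit [Nonempty n] in
/-- `rescale L (bavg L U)` IS the coarse-unit-lattice reading `cavg L U` of the average (definitional). [folklore] -/
theorem rescale_bavg_eq_cavg (L : ℕ) (U : Site 4 → Fin 4 → (Matrix n n ℂ)ˣ) :
    rescale L (bavg L U) = AveragingDeficitChartCalculus.cavg L U := rfl

/-- **[Balaban1985Averaging] Prop. 1 (11) READ ON `W`.**  If run B's configuration `U_B` is `U(n)`-valued and EVERYWHERE small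
at the fine threshold `a` (`SmallField U_B a`, `512·5·8·L²a ≤ 1`), then `W = rescale L (bavg L U_B)` is everywhere small at
`prop1Radius 4 L a = L²a + 226(8·5·8·L²a)²` — [Balaban1985Averaging] Prop. 1 (11) p. 24, PRINTED and in the tree as
`AveragingDeficitTwoLevelPrep.smallField_cavg` ∘ `B7Prop1Explicit.prop1_explicit`, applied BY NAME. [folklore] -/
theorem smallField_W (hL : 1 ≤ L) (hUB : IsUnitaryCfg UB) {a : ℝ} (ha : 0 ≤ a)
    (h512 : 512 * (4 + 1) * (4 + 4) * (L : ℝ) ^ 2 * a ≤ 1) (hsmall : SmallField UB a) :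
    SmallField (rescale L (bavg L UB)) (prop1Radius 4 L a) := by
  rw [rescale_bavg_eq_cavg]
  exact smallField_cavg hL hUB ha (by push_cast; linarith) hsmall

/-- **B SMALL ⇒ A SMALL UP TO THE SHELL.**  Under the hypotheses of `dev_close_of_n16`, if moreover `U_B` is `U(n)`-valued and
everywhere small at the fine threshold `a`, then EVERY slot variable of run A is at most `prop1Radius 4 L a + C_Q·θ^{13k}`
(B7 Prop. 1 for `W`, then the N16 width): with synchronised thresholds `ε_A(L^{−k})² = L²·ε_B(L^{−k−1})²` this is run A small
at its own threshold RAISED by the relative amount `(C_Q∕ε + O(ε))·θ^k` — the slack of X-15 V3's offset device is a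
single-run shell ABOVE run A's threshold (`T4IndicatorShell.smallInd_offset_sub`). [folklore] -/
theorem devA_le_of_smallField_B (hL : 2 ≤ L) (hN : 1 ≤ N) (hθ : 0 < θ) (hθ6 : θ ^ 6 = ((L : ℝ))⁻¹) (hb : 0 ≤ b)
    (hbs : 512 * (4 + 1) * (4 + 4) * (L : ℝ) ^ 2 * b ≤ 1) (hg : 0 ≤ g) (hC : 0 ≤ C) (hΛ₂' : 0 < Λ₂')
    (hcov : NE3EnergyRateWCov 4 𝒞 L N b g C Λ₁ Λ₂' dom)
    (hγ : 0 < γ) (hγ3 : C * (wallConst 4 L * (N : ℝ) ^ 2 * (Real.sqrt g * dualC2 4 L + 2 * b ^ 2 * dualC1 4 L)) ≤ γ ^ 3)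
    (hl₁ : 0 < l₁) (hΛl₁ : Λ₁ ≤ l₁ ^ 3) (hk : 1 ≤ k) (hfit : γ * (θ ^ k) ^ 2 ≤ l₁ * N) (hV : V ∈ dom)
    (hA : IsMinimiser 4 𝒞 L N k V UA) (hB : IsMinimiser 4 𝒞 L N (k + 1) V UB) (hreg : Regular 4 L N b g (k + 1) UB)
    (hUB : IsUnitaryCfg UB) {a : ℝ} (ha : 0 ≤ a) (h512 : 512 * (4 + 1) * (4 + 4) * (L : ℝ) ^ 2 * a ≤ 1)
    (hsmall : SmallField UB a) (z : Site 4) {μ ν : Fin 4} (hμν : μ ≠ ν) :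
    ‖((hol UA z (plaqWord μ ν) : (Matrix n n ℂ)ˣ) : Matrix n n ℂ) - 1‖
      ≤ prop1Radius 4 L a
        + (8 * l₁ * Real.sqrt (2 * γ * Λ₂') + 1536 * l₁ ^ 4 * γ ^ 2 * Real.exp (8 * l₁ ^ 2 * γ)) * θ ^ (13 * k) := by
  have hW := smallField_W (by omega : 1 ≤ L) hUB ha h512 hsmall z μ ν hμν
  have h := (abs_sub_le_iff.1
    (dev_close_of_n16 hL hN hθ hθ6 hb hbs hg hC hΛ₂' hcov hγ hγ3 hl₁ hΛl₁ hk hfit hV hA hB hreg z μ ν)).1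
  linarith

/-- … in indicator currency: for every threshold `t > prop1Radius 4 L a + C_Q·θ^{13k}` run A's small-field function of every
plaquette slot equals `1` — «`χ_B = 1` everywhere ⇒ `χ_A = 1` at the offset threshold». [folklore] -/
theorem smallInd_A_eq_one_of_smallField_B (hL : 2 ≤ L) (hN : 1 ≤ N) (hθ : 0 < θ) (hθ6 : θ ^ 6 = ((L : ℝ))⁻¹)
    (hb : 0 ≤ b) (hbs : 512 * (4 + 1) * (4 + 4) * (L : ℝ) ^ 2 * b ≤ 1) (hg : 0 ≤ g) (hC : 0 ≤ C) (hΛ₂' : 0 < Λ₂')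
    (hcov : NE3EnergyRateWCov 4 𝒞 L N b g C Λ₁ Λ₂' dom)
    (hγ : 0 < γ) (hγ3 : C * (wallConst 4 L * (N : ℝ) ^ 2 * (Real.sqrt g * dualC2 4 L + 2 * b ^ 2 * dualC1 4 L)) ≤ γ ^ 3)
    (hl₁ : 0 < l₁) (hΛl₁ : Λ₁ ≤ l₁ ^ 3) (hk : 1 ≤ k) (hfit : γ * (θ ^ k) ^ 2 ≤ l₁ * N) (hV : V ∈ dom)
    (hA : IsMinimiser 4 𝒞 L N k V UA) (hB : IsMinimiser 4 𝒞 L N (k + 1) V UB) (hreg : Regular 4 L N b g (k + 1) UB)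
    (hUB : IsUnitaryCfg UB) {a : ℝ} (ha : 0 ≤ a) (h512 : 512 * (4 + 1) * (4 + 4) * (L : ℝ) ^ 2 * a ≤ 1)
    (hsmall : SmallField UB a) {t : ℝ}
    (ht : prop1Radius 4 L a
      + (8 * l₁ * Real.sqrt (2 * γ * Λ₂') + 1536 * l₁ ^ 4 * γ ^ 2 * Real.exp (8 * l₁ ^ 2 * γ)) * θ ^ (13 * k) < t)
    (z : Site 4) {μ ν : Fin 4} (hμν : μ ≠ ν) :
    smallInd ‖((hol UA z (plaqWord μ ν) : (Matrix n n ℂ)ˣ) : Matrix n n ℂ) - 1‖ t = 1 := by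
  have h := devA_le_of_smallField_B hL hN hθ hθ6 hb hbs hg hC hΛ₂' hcov hγ hγ3 hl₁ hΛl₁ hk hfit hV hA hB hreg hUB ha h512
    hsmall z hμν
  unfold smallInd
  rw [if_pos (lt_of_le_of_lt h ht)]

end Transfer

end Summit.QuantumFields.YangMills.Theorems.N21ClosenessJunction

end
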